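import Literature.AnabelianGeometry.SemiGraphs.TemperedFixedLocusBaseImages
import Literature.AnabelianGeometry.SemiGraphs.TemperedNoEscapeOfFiniteGraph
import Literature.AnabelianGeometry.SemiGraphs.TreeSystemFixedPair
import HarnessLib

/-!
# [SemiAnbd] Thm 3.7 (iii) beyond finite `𝔾`: adjacency of compatible fixed systems from EDGE-SIZED IMAGES of the fixed loci

Mochizuki, *Semi-graphs of anabelioids*, Publ. RIMS **42** (2006), §3, Theorem 3.7 (iii), manuscript
p. 41 ("if `H` fixes two vertices of `𝒢_{∞,j}`, then these two vertices are joined to one another by a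
single [closed] edge"; Comments (2020) (6)(b) "the unique elements of the `E_{j,∞}` … form a compatible
system of closed edges fixed by `H`") [cite: MochizukiSemiAnbd2006, Thm 3.7(iii) p.41].

PROOF-ONLY (cell abc-iut, layer L3, GAP row G-t6g3-2b, sub-rows E1-V-tor / (f2); seat abc-iut-w6-d066;
no definition, no new named fact).  Companion of `TemperedFixedSystemOfFiniteImages.lean`: there the
first clause `hfix` of (FIX∞) was obtained from eventually FINITE level-`j` images of the `C`-fixed loci;
here the second clause `hadj` — and the two metric binders `hbdd` / `hdisp` of abc-iut-L3-t10's closer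
`compactInVerticialAt_of_noEscape` — are obtained from the sharper hypothesis that, for every level `j`,
the level-`j` image of the `C`-fixed locus of SOME level `k ≥ j` lies inside the end-vertices of ONE edge
of the tree `𝒢_{∞,j}` («edge-sized images»; desk input of this seat's memo THM37iii-LOCFIN-PERSISTENCE:
this holds at a locally finite `𝔾` over a persistent base vertex — NOT claimed in kernel):

* `VerticialLevelData.hadj_of_eventually_edge_images` — two compatible `C`-fixed vertex systems are, at
  every level where they differ, the two end-vertices of one edge, and that edge is `C`-fixed (in a tree two
  distinct vertices are joined by at most one edge, abc-iut-L3-t11's `SemiGraph.edge_unique_of_abuts`);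
* `VerticialLevelData.hbdd_of_eventually_edge_images` — hence any two compatible `C`-fixed systems stay
  at subdivision distance `≤ 4` (`hbdd` of the closer);
* `VerticialLevelData.finite_images_of_edge_images` — edge-sized images are finite images (the
  hypothesis of `hfix_of_eventually_finite_images`).

Nothing here asserts the edge-sized-images hypothesis for any `𝒢`; nothing bears on [IUTchIII] Cor. 3.12.
-/

namespace Literature.AnabelianGeometry.SemiGraphs

namespace ProfiniteSemiGraph

namespace VerticialLevelData

open CategoryTheory Topology

universe v u

variable {𝒢 : ProfiniteSemiGraph.{u}} {c : TemperedPiChart 𝒢} (D : VerticialLevelData.{v} 𝒢 c)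

/-- **`hadj` from edge-sized images** (print p. 41 "these two vertices are joined to one another by a
single [closed] edge"): if at every level `j` the image in `𝒢_{∞,j}` of the `C`-fixed locus of some level
`k ≥ j` lies inside the end-vertices of one edge `e_j`, then two compatible `C`-fixed vertex systems
`x, x'` with `x j ≠ x' j` are the two end-vertices of `e_j` (they are images of `C`-fixed vertices of level
`k`), through DISTINCT branches, and `e_j` is fixed by `C` (its translate by `g ∈ C` again joins the fixed
vertices `x j ≠ x' j`; `SemiGraph.edge_unique_of_abuts` in the tree `𝒢_{∞,j}`).
[cite: MochizukiSemiAnbd2006, Thm 3.7(iii) p.41] -/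
theorem hadj_of_eventually_edge_images (C : Subgroup c.G)
    (hedge : ∀ j : D.J, ∃ (k : D.J) (h : j ≤ k) (e : (D.tree j).Edge),
      ∀ x : (D.tree k).Vertex, (∀ g ∈ C, (D.act k g).hom.vertexMap x = x) →
        ∃ b : (D.tree j).Branch, (D.tree j).edgeOf b = e ∧
          (D.tree j).abuts b = some ((D.trans h).vertexMap x))
    (x x' : ∀ j, (D.tree j).Vertex)
    (hx : ∀ ⦃i j : D.J⦄ (h : i ≤ j), (D.trans h).vertexMap (x j) = x i)
    (hx' : ∀ ⦃i j : D.J⦄ (h : i ≤ j), (D.trans h).vertexMap (x' j) = x' i)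
    (hfx : ∀ g ∈ C, ∀ j, (D.act j g).hom.vertexMap (x j) = x j)
    (hfx' : ∀ g ∈ C, ∀ j, (D.act j g).hom.vertexMap (x' j) = x' j)
    (j : D.J) (hne : x j ≠ x' j) :
    ∃ (e : (D.tree j).Edge) (b b' : (D.tree j).Branch), b ≠ b' ∧
      (D.tree j).edgeOf b = e ∧ (D.tree j).edgeOf b' = e ∧
      (D.tree j).abuts b = some (x j) ∧ (D.tree j).abuts b' = some (x' j) ∧
      ∀ g ∈ C, (D.act j g).hom.edgeMap e = e := by
  obtain ⟨k, h, e, he⟩ := hedge j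
  obtain ⟨b, hbe, hbx⟩ := he (x k) (fun g hg => hfx g hg k)
  obtain ⟨b', hb'e, hb'x⟩ := he (x' k) (fun g hg => hfx' g hg k)
  rw [hx h] at hbx
  rw [hx' h] at hb'x
  have hbb' : b ≠ b' := by
    rintro rfl
    rw [hbx] at hb'x
    exact hne (Option.some_injective _ hb'x)
  refine ⟨e, b, b', hbb', hbe, hb'e, hbx, hb'x, fun g hg => ?_⟩
  -- the translate of `e` by `g` joins `g · x j = x j` and `g · x' j = x' j`
  set φ := (D.act j g).hom with hφ
  have h₁ : (D.tree j).abuts (φ.branchMap b) = some (x j) := by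
    rw [φ.abuts_branchMap b (x j) hbx, hfx g hg j]
  have h₂ : (D.tree j).abuts (φ.branchMap b') = some (x' j) := by
    rw [φ.abuts_branchMap b' (x' j) hb'x, hfx' g hg j]
  exact (SemiGraph.edge_unique_of_abuts (D.isTree j) hne hbe hb'e
    ((φ.edgeOf_branchMap b).trans (by rw [hbe])) ((φ.edgeOf_branchMap b').trans (by rw [hb'e]))
    hbx hb'x h₁ h₂).symm

/-- **`hbdd` from edge-sized images**: two compatible `C`-fixed vertex systems stay at subdivision
distance `≤ 4` at every level (equal, or the two end-vertices of one edge: `v – b – e – b' – v'`) — the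
binder `hbdd` of abc-iut-L3-t10's `compactInVerticialAt_of_noEscape` for `C`.
[cite: MochizukiSemiAnbd2006, Thm 3.7(iii) p.41] -/
theorem hbdd_of_eventually_edge_images (C : Subgroup c.G)
    (hedge : ∀ j : D.J, ∃ (k : D.J) (h : j ≤ k) (e : (D.tree j).Edge),
      ∀ x : (D.tree k).Vertex, (∀ g ∈ C, (D.act k g).hom.vertexMap x = x) →
        ∃ b : (D.tree j).Branch, (D.tree j).edgeOf b = e ∧
          (D.tree j).abuts b = some ((D.trans h).vertexMap x))
    (x x' : ∀ j, (D.tree j).Vertex)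
    (hx : ∀ ⦃i j : D.J⦄ (h : i ≤ j), (D.trans h).vertexMap (x j) = x i)
    (hx' : ∀ ⦃i j : D.J⦄ (h : i ≤ j), (D.trans h).vertexMap (x' j) = x' i)
    (hfx : ∀ g ∈ C, ∀ j, (D.act j g).hom.vertexMap (x j) = x j)
    (hfx' : ∀ g ∈ C, ∀ j, (D.act j g).hom.vertexMap (x' j) = x' j) :
    ∃ N : ℕ, ∀ j, (D.tree j).subdivision.dist (Sum.inl (x j)) (Sum.inl (x' j)) ≤ N := by
  refine ⟨4, fun j => ?_⟩
  by_cases hj : x j = x' j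
  · rw [hj, SimpleGraph.dist_self]; exact Nat.zero_le _
  · obtain ⟨e, b, b', -, hbe, hb'e, hbx, hb'x, -⟩ :=
      D.hadj_of_eventually_edge_images C hedge x x' hx hx' hfx hfx' j hj
    exact SemiGraph.subdivision_dist_le_four_of_joined hbe hb'e hbx hb'x

/-- **Edge-sized images are finite images**: if the level-`j` image of the `C`-fixed locus of level `k`
lies inside the end-vertices of one edge, it is finite (an edge has finitely many branches) — the
hypothesis of `hfix_of_eventually_finite_images` (`TemperedFixedSystemOfFiniteImages.lean`).
[cite: MochizukiSemiAnbd2006, Thm 3.7(iii) p.41] -/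
theorem finite_images_of_edge_images (C : Subgroup c.G)
    (hedge : ∀ j : D.J, ∃ (k : D.J) (h : j ≤ k) (e : (D.tree j).Edge),
      ∀ x : (D.tree k).Vertex, (∀ g ∈ C, (D.act k g).hom.vertexMap x = x) →
        ∃ b : (D.tree j).Branch, (D.tree j).edgeOf b = e ∧
          (D.tree j).abuts b = some ((D.trans h).vertexMap x)) (j : D.J) :
    ∃ (k : D.J) (h : j ≤ k),
      ((D.trans h).vertexMap '' {x : (D.tree k).Vertex | ∀ g ∈ C, (D.act k g).hom.vertexMap x = x}).Finite := by
  obtain ⟨k, h, e, he⟩ := hedge j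
  refine ⟨k, h, ?_⟩
  -- the branches of `e` are finitely many (exactly two)
  have hfinB : {b : (D.tree j).Branch | (D.tree j).edgeOf b = e}.Finite := by
    obtain ⟨b₁, b₂, -, -, -, hall⟩ := (D.tree j).two_branches e
    refine ((Set.finite_singleton b₂).insert b₁).subset ?_
    intro b hb
    rcases hall b hb with rfl | rfl
    · exact Set.mem_insert _ _
    · exact Set.mem_insert_of_mem _ rfl
  -- hence so are the end-vertices of `e`
  have hfinV : {v : (D.tree j).Vertex | ∃ b : (D.tree j).Branch, (D.tree j).edgeOf b = e ∧
      (D.tree j).abuts b = some v}.Finite := by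
    have hpre : (Option.some ⁻¹' ((fun b : (D.tree j).Branch => (D.tree j).abuts b) ''
        {b : (D.tree j).Branch | (D.tree j).edgeOf b = e})).Finite :=
      (hfinB.image _).preimage (Set.injOn_of_injective (Option.some_injective _))
    refine hpre.subset ?_
    rintro v ⟨b, hbe, hbv⟩
    exact ⟨b, hbe, hbv⟩
  -- and the image of the fixed locus lies among them
  refine hfinV.subset ?_
  rintro _ ⟨x, hx, rfl⟩
  exact he x hx

end VerticialLevelData

end ProfiniteSemiGraph

end Literature.AnabelianGeometry.SemiGraphs
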